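import Summits.CriticalPhenomena.CardyFormulaZ2.Theorems.CardyMagicRigidityPinchResamplingDefs
import Summits.CriticalPhenomena.CardyFormulaZ2.Theorems.CardyMagicRigidityNestingRigidityOneGenerationTLocality
import HarnessLib

/-!
# Locality of the pinch event, and the exact regime `m = s` of `FourArmCouplingT`

Crux `Summit.CriticalPhenomena.CardyFormulaZ2.Theses.CardyMagicRigidity.NestingRigidity`
(stmt-CriticalPhenomena-4835), line `pinch-resampling` v2 (definitions module
`CardyMagicRigidityPinchResamplingDefs`), helper toward the registered stub
`stub_fourArmCouplingT : FourArmCouplingT` (S2: exterior forgetting, in total variation, for critical site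
percolation on `𝕋` conditioned on the pinch event `TPinch x y m n` = exactly two open and two closed crossing
clusters of the hexagonal annulus `Λ_{2n}(x) ∖ Λ_m(y)`).

* §1 **Paths inside a region only read the edges inside it** (`pathIn_congr_of_adj_iff`), hence the cluster-form
  predicates `IsCrossing`, `TwoCrossingClusters`, `HookedUp` of the Defs module only read the edges of the
  colour graph inside the annulus / the big region (`isCrossing_congr`, `twoCrossingClusters_congr`,
  `hookedUp_congr`).
* §2 **Locality**: `TPinch x y m n` is `DeterminedBy` the sites of the annulus `Λ_{2n}(x) ∖ Λ_m(y)`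
  (`tPinch_determinedBy`) and `THook x y m n` by the sites of `Λ_{2n}(x)` (`tHook_determinedBy`); the balls
  `tBall x n` are finite translates of `triBall n` (`tBall_eq_image`, `tBall_finite`), so both events are
  measurable (`measurableSet_tPinch`, `measurableSet_tHook`).
* §3 **The exact regime `m = s`** (registered anchor `fourArmCouplingT_exact_of_eq`): when the interior ball of
  `FourArmCouplingT` is the hole itself (this contains `s = 0`), an interior event is independent of
  `TPinch ∩ F` for every exterior event `F` (product structure of `triSitePercolation half`, through
  `measureReal_inter_of_determined` of `…OneGenerationTLocality`), so the cross-multiplied difference of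
  `FourArmCouplingT` vanishes identically, for every `n` (`fourArmCouplingT_of_eq`: the inequality with any
  `b ≥ 0`).
* §4 **No degenerate crossings**: under the standing constraint `2 |y - x|_𝕋 + 2 m ≤ n` the inner and outer
  layers of the pinch annulus are disjoint once `n ≥ 1` (`disjoint_innerLayer_outerLayer`), so every vertex
  starting a crossing of colour `c` has colour `c` (`colour_of_isCrossing_tPinch`; the one-vertex path
  `PathIn H A v v ↔ v ∈ A` never counts as a crossing), and for `n = 0` the annulus is empty and
  `TPinch x y m 0 = ∅` (`tPinch_eq_empty_of_zero`).

These are the typing-audit facts of the S2 brief (no vacuity, no junk crossings) and the bricks B1/B3; the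
stub itself (the coupling property of Garban–Pete–Schramm, arXiv:1008.1378, Prop. 11, for the exactly-four
sub-event and arbitrary exterior events) is not proved here.
-/

noncomputable section

namespace Summit.CriticalPhenomena.CardyFormulaZ2.Cruxes.NestingRigidity.PinchResampling

open MeasureTheory Set Literature.Probability.Percolation Literature.Probability.LatticeModels


/-! ## §1 Paths inside a region only read the edges inside that region -/

section PathCongr

variable {V : Type*} {H H' : SimpleGraph V} {A : Set V}

-- adapted from `Literature.Probability.Percolation.DCT16.pathIn_congrGraph` (SharpnessDCTProofs), not imported here
/-- Change of graph along a path inside `A`: if every `H`-edge between two vertices of `A` is an `H'`-edge,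
an `H`-path inside `A` is an `H'`-path inside `A`. -/
theorem pathIn_of_adj_imp (h : ∀ a ∈ A, ∀ b ∈ A, H.Adj a b → H'.Adj a b) {u v : V}
    (huv : PathIn H A u v) : PathIn H' A u v := by
  obtain ⟨hu, p⟩ := huv
  refine ⟨hu, ?_⟩
  induction p with
  | refl => exact Relation.ReflTransGen.refl
  | @tail b c hub hbc ih =>
    exact ih.tail ⟨h b (PathIn.right_mem (show PathIn H A u b from ⟨hu, hub⟩)) c hbc.2 hbc.1, hbc.2⟩

/-- Two graphs with the same edges between vertices of `A` have the same paths inside `A`. -/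
theorem pathIn_congr_of_adj_iff (h : ∀ a ∈ A, ∀ b ∈ A, (H.Adj a b ↔ H'.Adj a b)) (u v : V) :
    PathIn H A u v ↔ PathIn H' A u v :=
  ⟨pathIn_of_adj_imp fun a ha b hb ↦ (h a ha b hb).1, pathIn_of_adj_imp fun a ha b hb ↦ (h a ha b hb).2⟩

/-- Crossings of the annulus `O ∖ I` only read the edges of `H` inside the annulus. -/
theorem isCrossing_congr (G : SimpleGraph V) {I O : Set V}
    (h : ∀ a ∈ O \ I, ∀ b ∈ O \ I, (H.Adj a b ↔ H'.Adj a b)) (v : V) :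
    IsCrossing G H I O v ↔ IsCrossing G H' I O v := by
  simp only [IsCrossing, pathIn_congr_of_adj_iff h]

/-- `TwoCrossingClusters` only reads the edges of `H` inside the annulus `O ∖ I`. -/
theorem twoCrossingClusters_congr (G : SimpleGraph V) {I O : Set V}
    (h : ∀ a ∈ O \ I, ∀ b ∈ O \ I, (H.Adj a b ↔ H'.Adj a b)) :
    TwoCrossingClusters G H I O ↔ TwoCrossingClusters G H' I O := by
  simp only [TwoCrossingClusters, isCrossing_congr G h, pathIn_congr_of_adj_iff h]

/-- `HookedUp` only reads the edges of `H` inside the big region `O`. -/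
theorem hookedUp_congr (G : SimpleGraph V) {I O : Set V}
    (h : ∀ a ∈ O, ∀ b ∈ O, (H.Adj a b ↔ H'.Adj a b)) :
    HookedUp G H I O ↔ HookedUp G H' I O := by
  have h' : ∀ a ∈ O \ I, ∀ b ∈ O \ I, (H.Adj a b ↔ H'.Adj a b) := fun a ha b hb ↦ h a ha.1 b hb.1
  simp only [HookedUp, isCrossing_congr G h', pathIn_congr_of_adj_iff h]

end PathCongr

/-! ## §2 Locality and measurability of the pinch and hook-up events -/

section Locality

/-- Two site configurations agreeing on `A` have the same colour-`c` edges inside `A`. -/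
theorem tColourGraph_adj_iff_of_inter_eq {ω ω' : SiteConfig (Site 2)} {A : Set (Site 2)}
    (hA : ω ∩ A = ω' ∩ A) (c : Bool) :
    ∀ a ∈ A, ∀ b ∈ A, ((tColourGraph ω c).Adj a b ↔ (tColourGraph ω' c).Adj a b) := by
  have key : ∀ v ∈ A, (v ∈ ω ↔ v ∈ ω') := fun v hv ↦
    ⟨fun h ↦ ((Set.ext_iff.1 hA v).1 ⟨h, hv⟩).1, fun h ↦ ((Set.ext_iff.1 hA v).2 ⟨h, hv⟩).1⟩
  intro a ha b hb
  simp only [tColourGraph, siteOpenGraph_adj, mem_setOf_eq, key a ha, key b hb]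

/-- The four-arm event of the annulus `O ∖ I` only reads the sites of the annulus. -/
theorem tFourArms_iff_of_inter_eq {ω ω' : SiteConfig (Site 2)} {I O : Set (Site 2)}
    (h : ω ∩ (O \ I) = ω' ∩ (O \ I)) : TFourArms ω I O ↔ TFourArms ω' I O := by
  simp only [TFourArms, twoCrossingClusters_congr triGraph (tColourGraph_adj_iff_of_inter_eq h _)]

/-- **Locality of the pinch event**: `TPinch x y m n` is determined by the sites of the annulus
`Λ_{2n}(x) ∖ Λ_m(y)` (in particular it does not read the hole `Λ_m(y)`). -/
theorem tPinch_determinedBy (x y : Site 2) (m n : ℕ) :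
    DeterminedBy (TPinch x y m n) (tBall x (2 * n) \ tBall y m) := by
  rw [determinedBy_iff]
  intro ω ω' h
  exact tFourArms_iff_of_inter_eq h

/-- **Locality of the hook-up event**: `THook x y m n` is determined by the sites of the big ball `Λ_{2n}(x)`. -/
theorem tHook_determinedBy (x y : Site 2) (m n : ℕ) : DeterminedBy (THook x y m n) (tBall x (2 * n)) := by
  rw [determinedBy_iff]
  intro ω ω' h
  exact hookedUp_congr triGraph (tColourGraph_adj_iff_of_inter_eq h true)

/-- The hexagonal ball `Λ_n(x)` is the translate by `x` of the `Finset` ball `triBall n`. -/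
theorem tBall_eq_image (x : Site 2) (n : ℕ) : tBall x n = (· + x) '' ↑(triBall n) := by
  ext v
  simp only [tBall, mem_setOf_eq, mem_image, Finset.mem_coe, mem_triBall_iff]
  constructor
  · intro h
    exact ⟨v - x, h, sub_add_cancel v x⟩
  · rintro ⟨w, hw, rfl⟩
    simpa using hw

/-- The hexagonal ball `Λ_n(x)` is finite. -/
theorem tBall_finite (x : Site 2) (n : ℕ) : (tBall x n).Finite := by
  rw [tBall_eq_image]
  exact (triBall n).finite_toSet.image _

/-- An event determined by a finite set of sites is measurable (`Set.Finite` form of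
`DeterminedBy.measurableSet_of_finset`). -/
theorem measurableSet_of_determinedBy_finite {ι : Type*} {A : Set (Set ι)} {S : Set ι} (hS : S.Finite)
    (h : DeterminedBy A S) : MeasurableSet A := by
  rw [← hS.coe_toFinset] at h
  exact h.measurableSet_of_finset

/-- The pinch event is measurable. -/
theorem measurableSet_tPinch (x y : Site 2) (m n : ℕ) : MeasurableSet (TPinch x y m n) :=
  measurableSet_of_determinedBy_finite (tBall_finite x (2 * n))
    ((tPinch_determinedBy x y m n).mono fun _ hv ↦ hv.1)

/-- The hook-up event is measurable. -/
theorem measurableSet_tHook (x y : Site 2) (m n : ℕ) : MeasurableSet (THook x y m n) :=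
  measurableSet_of_determinedBy_finite (tBall_finite x (2 * n)) (tHook_determinedBy x y m n)

end Locality

/-! ## §3 The exact regime `m = s`: interior ball = hole -/

section Exact

/-- Unfolded subadditivity of the hexagonal norm along `v - x = (v - y) + (y - x)`. -/
theorem triNorm_sub_le_triNorm_sub_add (v y x : Site 2) :
    triNorm (v - x) ≤ triNorm (v - y) + triNorm (y - x) := by
  obtain ⟨h0, h1, h2⟩ := triNorm_le_iff.1 (le_refl (triNorm (v - y)))
  obtain ⟨k0, k1, k2⟩ := triNorm_le_iff.1 (le_refl (triNorm (y - x)))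
  rw [triNorm_le_iff]
  simp only [Pi.sub_apply, abs_le] at *
  omega

/-- `Λ_m(y) ⊆ Λ_n(x)` as soon as `|y - x|_𝕋 + m ≤ n`. -/
theorem tBall_subset_tBall {x y : Site 2} {m n : ℕ} (h : triNorm (y - x) + m ≤ n) : tBall y m ⊆ tBall x n := by
  intro v hv
  simp only [tBall, mem_setOf_eq] at hv ⊢
  have := triNorm_sub_le_triNorm_sub_add v y x
  omega

/-- An event determined by `S` is unchanged by restricting the configuration to `S`. -/
theorem inter_mem_iff_of_determinedBy {ι : Type*} {A : Set (Set ι)} {S : Set ι} (h : DeterminedBy A S)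
    (ω : Set ι) : ω ∩ S ∈ A ↔ ω ∈ A :=
  (determinedBy_iff A S).1 h (ω ∩ S) ω (by rw [inter_assoc, inter_self])

/-- **Interior/exterior factorisation** under `P_{1/2}` on `𝕋`: an event determined by the sites of a set
`S` and an event determined by the sites off `S` are independent (product structure of
`triSitePercolation half = sitePercolation (Site 2) half`, via `measureReal_inter_of_determined`). -/
theorem measureReal_inter_of_determinedBy_compl {S : Set (Site 2)} {A B : Set (SiteConfig (Site 2))}
    (hAm : MeasurableSet A) (hBm : MeasurableSet B) (hA : DeterminedBy A S) (hB : DeterminedBy B Sᶜ) :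
    (triSitePercolation half).real (A ∩ B) =
      (triSitePercolation half).real A * (triSitePercolation half).real B :=
  MarkovCascadeOneGeneration.measureReal_inter_of_determined half disjoint_compl_right hAm hBm
    (inter_mem_iff_of_determinedBy hA) (inter_mem_iff_of_determinedBy hB)

/-- If `E` is independent of `A ∩ F` and of `A ∩ F'`, the cross-multiplied difference vanishes. -/
theorem crossMul_eq_zero_of_factor {Ω : Type*} [MeasurableSpace Ω] {P : Measure Ω} {E A F F' : Set Ω}
    (hF : P.real (E ∩ (A ∩ F)) = P.real E * P.real (A ∩ F))
    (hF' : P.real (E ∩ (A ∩ F')) = P.real E * P.real (A ∩ F')) :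
    P.real (E ∩ A ∩ F) * P.real (A ∩ F') - P.real (E ∩ A ∩ F') * P.real (A ∩ F) = 0 := by
  rw [inter_assoc, inter_assoc, hF, hF']
  ring

/-- The pinch event cut by an exterior event of `Λ_n(x)` is determined by the sites off the hole `Λ_m(y)`,
provided `Λ_m(y) ⊆ Λ_n(x)`. -/
theorem tPinch_inter_determinedBy_compl {x y : Site 2} {m n : ℕ} (h : triNorm (y - x) + m ≤ n)
    {F : Set (SiteConfig (Site 2))} (hF : DeterminedBy F (tBall x n)ᶜ) :
    DeterminedBy (TPinch x y m n ∩ F) (tBall y m)ᶜ :=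
  ((tPinch_determinedBy x y m n).mono fun _ hv ↦ hv.2).inter
    (hF.mono (compl_subset_compl.2 (tBall_subset_tBall h)))

/-- **The exact regime `m = s` of `FourArmCouplingT` (registered helper of stub S2).**  When the interior
ball IS the hole (`s = m`; this contains the case `s = 0`, which forces `m = 0`), an interior event `E`
(determined by the sites of `Λ_m(y)`) is independent of `TPinch x y m n ∩ F` for every exterior event `F`
of `Λ_n(x)` (determined by the sites off `Λ_n(x) ⊇ Λ_m(y)`; the pinch event reads only the annulus
`Λ_{2n}(x) ∖ Λ_m(y)`), so the cross-multiplied difference of `FourArmCouplingT` vanishes identically —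
no constraint `M s ≤ n` is needed. -/
theorem fourArmCouplingT_exact_of_eq : ∀ (x y : Site 2) (m n : ℕ), 2 * triNorm (y - x) + 2 * m ≤ n → ∀ F F' : Set (SiteConfig (Site 2)), MeasurableSet F → MeasurableSet F' → DeterminedBy F (tBall x n)ᶜ → DeterminedBy F' (tBall x n)ᶜ → ∀ E : Set (SiteConfig (Site 2)), MeasurableSet E → DeterminedBy E (tInt y m) → (triSitePercolation half).real (E ∩ TPinch x y m n ∩ F) * (triSitePercolation half).real (TPinch x y m n ∩ F') - (triSitePercolation half).real (E ∩ TPinch x y m n ∩ F') * (triSitePercolation half).real (TPinch x y m n ∩ F) = 0 := by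
  intro x y m n hn F F' hFm hF'm hF hF' E hEm hE
  have h : triNorm (y - x) + m ≤ n := by
    have := triNorm_nonneg (y - x)
    omega
  exact crossMul_eq_zero_of_factor
    (measureReal_inter_of_determinedBy_compl hEm ((measurableSet_tPinch x y m n).inter hFm) hE
      (tPinch_inter_determinedBy_compl h hF))
    (measureReal_inter_of_determinedBy_compl hEm ((measurableSet_tPinch x y m n).inter hF'm) hE
      (tPinch_inter_determinedBy_compl h hF'))

/-- The exact regime in the shape of `FourArmCouplingT`: for `s = m` the coupling inequality holds with ANY
`b ≥ 0` and without the scale constraint `M s ≤ n`. -/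
theorem fourArmCouplingT_of_eq {b : ℝ} (hb : 0 ≤ b) (x y : Site 2) (m n : ℕ)
    (hn : 2 * triNorm (y - x) + 2 * m ≤ n) (F F' : Set (SiteConfig (Site 2))) (hFm : MeasurableSet F)
    (hF'm : MeasurableSet F') (hF : DeterminedBy F (tBall x n)ᶜ) (hF' : DeterminedBy F' (tBall x n)ᶜ)
    (E : Set (SiteConfig (Site 2))) (hEm : MeasurableSet E) (hE : DeterminedBy E (tInt y m)) :
    |(triSitePercolation half).real (E ∩ TPinch x y m n ∩ F) * (triSitePercolation half).real (TPinch x y m n ∩ F') -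
        (triSitePercolation half).real (E ∩ TPinch x y m n ∩ F') * (triSitePercolation half).real (TPinch x y m n ∩ F)| ≤
      b * (triSitePercolation half).real (TPinch x y m n ∩ F) * (triSitePercolation half).real (TPinch x y m n ∩ F') := by
  rw [fourArmCouplingT_exact_of_eq x y m n hn F F' hFm hF'm hF hF' E hEm hE, abs_zero]
  have := measureReal_nonneg (μ := triSitePercolation half) (s := TPinch x y m n ∩ F)
  have := measureReal_nonneg (μ := triSitePercolation half) (s := TPinch x y m n ∩ F')
  positivity

end Exact

/-! ## §4 No degenerate crossings: for `n ≥ 1` the two layers are disjoint and crossings are monochromatic -/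

section Layers

/-- The inner layer of an annulus with hole `Λ_m(y)` lies within `𝕋`-distance `m + 1` of `y`. -/
theorem triNorm_le_of_mem_innerLayer {y : Site 2} {m : ℕ} {O : Set (Site 2)} {v : Site 2}
    (hv : v ∈ innerLayer triGraph (tBall y m) O) : triNorm (v - y) ≤ m + 1 := by
  obtain ⟨-, w, hw, hvw⟩ := hv
  simp only [tBall, mem_setOf_eq] at hw
  have h1 : triNorm (v - y) ≤ triNorm (w - y) + 1 := by
    have hadj : triGraph.Adj (w - y) (v - y) := by
      simpa [Site.shift_apply, sub_eq_add_neg] using (triGraph_adj_shift_iff (-y) w v).2 hvw.symm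
    exact triNorm_le_triNorm_add_one_of_adj hadj
  omega

/-- The outer layer of an annulus with outer ball `Λ_k(x)` lies on the sphere `|v - x|_𝕋 = k`. -/
theorem le_triNorm_of_mem_outerLayer {x : Site 2} {k : ℕ} {I : Set (Site 2)} {v : Site 2}
    (hv : v ∈ outerLayer triGraph I (tBall x k)) : (k : ℤ) ≤ triNorm (v - x) := by
  obtain ⟨-, w, hw, hvw⟩ := hv
  simp only [tBall, mem_setOf_eq, not_le] at hw
  have h1 : triNorm (w - x) ≤ triNorm (v - x) + 1 := by
    have hadj : triGraph.Adj (v - x) (w - x) := by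
      simpa [Site.shift_apply, sub_eq_add_neg] using (triGraph_adj_shift_iff (-x) v w).2 hvw
    exact triNorm_le_triNorm_add_one_of_adj hadj
  omega

/-- **The layers of the pinch annulus are disjoint** as soon as `n ≥ 1` (under the standing geometric
constraint `2 |y - x|_𝕋 + 2 m ≤ n` of `FourArmCouplingT`, where `m ≤ s`): no site is both adjacent to the hole
`Λ_m(y)` and to the outside of `Λ_{2n}(x)`.  (For `n = 0` the constraint forces `y = x`, `m = 0` and the
annulus is empty.) -/
theorem disjoint_innerLayer_outerLayer {x y : Site 2} {m n : ℕ} (h : 2 * triNorm (y - x) + 2 * m ≤ n)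
    (hn : 1 ≤ n) :
    Disjoint (innerLayer triGraph (tBall y m) (tBall x (2 * n))) (outerLayer triGraph (tBall y m) (tBall x (2 * n))) := by
  rw [Set.disjoint_left]
  intro v hin hout
  have h1 := triNorm_le_of_mem_innerLayer hin
  have h2 := le_triNorm_of_mem_outerLayer hout
  have h3 := triNorm_sub_le_triNorm_sub_add v y x
  have h4 := triNorm_nonneg (y - x)
  push_cast at h2
  omega

/-- A path inside `A` between two distinct vertices starts with an edge. -/
theorem exists_adj_of_pathIn_ne {V : Type*} {H : SimpleGraph V} {A : Set V} {u v : V} (h : PathIn H A u v)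
    (huv : u ≠ v) : ∃ b, H.Adj u b := by
  obtain ⟨-, p⟩ := h
  rcases p.cases_head with rfl | ⟨b, hb, -⟩
  · exact (huv rfl).elim
  · exact ⟨b, hb.1⟩

/-- **Crossings are monochromatic**: when the layers are disjoint, a vertex starting a crossing of colour `c`
has colour `c` (the crossing path is non-trivial, and an edge of `tColourGraph ω c` has both endpoints of
colour `c`).  This rules out the degenerate one-vertex "crossings" `PathIn H A v v ↔ v ∈ A`. -/
theorem colour_of_isCrossing {ω : SiteConfig (Site 2)} {c : Bool} {I O : Set (Site 2)}
    (hd : Disjoint (innerLayer triGraph I O) (outerLayer triGraph I O)) {v : Site 2}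
    (hv : IsCrossing triGraph (tColourGraph ω c) I O v) : (v ∈ ω) = c := by
  obtain ⟨hin, w, hw, hp⟩ := hv
  have hne : v ≠ w := fun h ↦ Set.disjoint_left.1 hd hin (h ▸ hw)
  obtain ⟨b, hb⟩ := exists_adj_of_pathIn_ne hp hne
  rw [tColourGraph, siteOpenGraph_adj] at hb
  exact hb.2.1

/-- In the pinch annulus with `n ≥ 1`, every vertex starting an open (resp. closed) crossing is open
(resp. closed). -/
theorem colour_of_isCrossing_tPinch {x y : Site 2} {m n : ℕ} (h : 2 * triNorm (y - x) + 2 * m ≤ n) (hn : 1 ≤ n)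
    {ω : SiteConfig (Site 2)} {c : Bool} {v : Site 2}
    (hv : IsCrossing triGraph (tColourGraph ω c) (tBall y m) (tBall x (2 * n)) v) : (v ∈ ω) = c :=
  colour_of_isCrossing (disjoint_innerLayer_outerLayer h hn) hv

/-- For `n = 0` the geometric constraint empties the annulus: the pinch event is impossible (all four
probabilities in `FourArmCouplingT` vanish). -/
theorem tPinch_eq_empty_of_zero {x y : Site 2} {m : ℕ} (h : 2 * triNorm (y - x) + 2 * m ≤ ((0 : ℕ) : ℤ)) :
    TPinch x y m 0 = ∅ := by
  have h0 : triNorm (y - x) = 0 := by have := triNorm_nonneg (y - x); omega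
  have hO : tBall x (2 * 0) \ tBall y m = ∅ := by
    ext v
    simp only [tBall, Set.mem_sdiff, mem_setOf_eq, mem_empty_iff_false, iff_false, not_and, not_not, mul_zero,
      Nat.cast_zero]
    intro hv
    have h1 := triNorm_sub_le_triNorm_sub_add v x y
    have h2 : triNorm (x - y) = 0 := by rw [← triNorm_neg, neg_sub, h0]
    have h3 := triNorm_nonneg (v - x)
    omega
  ext ω
  refine ⟨fun hω ↦ ?_, fun hω ↦ hω.elim⟩
  obtain ⟨⟨⟨v₁, -, hc₁, -, -⟩, -⟩, -⟩ := hω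
  have hv₁ : v₁ ∈ tBall x (2 * 0) \ tBall y m := hc₁.1.1
  rw [hO] at hv₁
  exact hv₁

end Layers

end Summit.CriticalPhenomena.CardyFormulaZ2.Cruxes.NestingRigidity.PinchResampling

end
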